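import Literature.Probability.RandomPlanarGeometry.HexSAWSurfaceWallRenewal
import Literature.Probability.RandomPlanarGeometry.HexSAWSurfaceFourteenSeeds
import HarnessLib

/-!
# Thirty-six irreducible positive wall bridges of lengths 12–18, and the weighted lower bounds
# `6y ≤ Λ₁₂(y)`, `15y + 3y² ≤ Λ₁₄(y)`, `11y² ≤ Λ₁₆(y)`, `y³ ≤ Λ₁₈(y)`

Companion («BLOCKS») of «WALL-RENEWAL» (`HexSAWSurfaceWallRenewal`: the renewal structure of POSITIVE wall bridges of self-avoiding
walks on the brick-wall (hexagonal) lattice along a zigzag wall with contact fugacity `y`, Kesten's irreducible blocks `ipwb n` and their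
polynomials `Λ_n(y) = IPWB n y`), of «FOURTH-ORDER-LOWER» (the table-walk plumbing `Tab.walk`, `Tab.Facts`) and of «FOURTEEN-SEEDS» /
«FIFTH-ORDER-LOWER» (the explicit one-visit wall bridges `Twelve.W : Fin 9 → …`, `Fourteen.W : Fin 26 → …`); it imports built modules only
(«TEN-THREE»'s `mem_pwb_of_facts` is re-derived privately).  This module EXHIBITS, as explicit table walks checked by
`decide`, irreducible positive wall bridges in every class `(s, v)` (half-length `s`, `v` surface visits) with `s − v ≤ 6` beyond those
already in the tree (`(1,1)`, `(3,1)`, `(4,1)`, `(5,1)×3` in «TEN-THREE»; `(6,2)` in «FLOOR-SEVENTEEN»):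

* §1 two generic tools: ★ `mem_ipwb_of_facts_of_witness` — a table walk with `Tab.Facts` is an irreducible positive wall bridge as soon as
  every interior even surface visit `k` carries a decidable NON-RENEWAL WITNESS (an earlier abscissa `X_i > X_k`, `1 ≤ i ≤ k`, or a later
  abscissa `X_j ≤ X_k`, `k < j ≤ L`); ★ `card_mul_pow_le_IPWB` / `card_mul_pow_add_le_IPWB` — an injective exhibited family of `N` blocks
  with `v` visits each gives `N·y^v ≤ Λ_m(y)`, and two families with different visit numbers add.
* §2 tables: three two-visit blocks of length fourteen (`FourteenTwo`), eleven two-visit blocks of length sixteen (`SixteenTwo`), the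
  unique three-visit block of length eighteen (`EighteenThree`) — each containing an OVERHANG (a later return to an earlier abscissa, e.g. the
  hook `(0,0)(1,0)(2,0)(3,0)(3,−1)(2,−1)(2,−2)` of «FLOOR-SEVENTEEN»'s `Twelve.qw`), which is what defeats the renewal at the interior visits.
* §3 per family: `Tab.Facts` (left-proper) and the witness clause by `decide`, visit counts by kernel evaluation, injective abscissa
  codes, ★ memberships `W i ∈ ipwb m` (length symbolic); the one-visit families are the LEFT-PROPER members of the tree's tables:
  `TwelveOne.W = Twelve.W 0…5` (six of nine) and `FourteenOne.W = Fourteen.W 7…21` (fifteen of twenty-six).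
* §4 ★★ the four weighted lower bounds `six_mul_le_IPWB_twelve`, `fifteen_mul_add_three_sq_le_IPWB_fourteen`, `eleven_sq_le_IPWB_sixteen`,
  `cube_le_IPWB_eighteen` (`y ≥ 0`, lengths symbolic `(hm : m = 12)` …, so that no closed `ipwb 14` is ever unfolded).

USE.  With Kesten's identity `Σ_s Λ_{2s}(y)/β(y)^{2s} = 1` (`hasSum_pwbLaw`) these bounds are exactly the input of the SIXTH-ORDER LOWER
bound `β(y)² ≥ y + 1/y + 1/y² + 2/y³ + 4/y⁴ + (6 − o(1))/y⁵` (companion «SIXTH-LOWER»), matching «SIXTH-ORDER-UPPER»'s `… + 6/y⁵ + O(y⁻⁶)`.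
A brute-force census (not used in any proof) says the exhibited lists are COMPLETE in their classes: `N₆₁ = 6`, `N₇₁ = 15`, `N₇₂ = 3`,
`N₈₂ = 11`, `N₉₃ = 1`.

HONEST LABEL.  LANE LEMMAS, kernel-checked tables; the model-specific lists are computed here (lane results, not quotations).  The
printed sources carry the definitions (bridges, irreducible bridges, renewal/Kesten structure: [MadrasSlade1993, §1.2, §4.2; Kesten 1963,
§4]), the surface-contact weight `y^{visits}` [BeatonBousquetMelouDeGierDuminilCopinGuttmann2014, §3.1] and finite-lattice enumeration
tables of this kind [EntingJensen2009, §7.4.2].  NOT CLAIMED: completeness of the lists (no classification theorem is proved here), any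
count `N_{s,v}` as an equality, anything about `β`.
-/

namespace Literature.Probability.RandomPlanarGeometry.SAW.HexBW.Wall

open Finset Filter Function
open Literature.Probability.LatticeModels
open _root_.Topology Asymptotics

variable {y : ℝ} {n : ℕ} {ω : ℕ → Site 2}

/-! ### §1  Generic tools: a decidable non-renewal witness, and weighted counts of exhibited families -/

/-- A table walk satisfying `Tab.Facts` (left-proper: `X_i ≥ 1` for `1 ≤ i ≤ L`, and `X_i ≤ X_L`) is a POSITIVE wall bridge (length and
walk symbolic).  Private twin of «TEN-THREE»'s `mem_pwb_of_facts`, which this file does not import.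
[cite: MadrasSlade1993, Section 1.2, Definition 1.2.4] [cite: EntingJensen2009, Section 7.4.2, Fig. 7.10] -/
private theorem mem_pwb_of_facts_bl {L m : ℕ} {X Y : ℕ → ℤ} {w : ℕ → Site 2} (hw : w = Tab.walk L X Y) (h : Tab.Facts L X Y)
    (hm : m = L) : w ∈ pwb m := by
  obtain ⟨h0, hfr, hbw, hinj, hH, harch, hwb, -⟩ := Tab.walk_components h
  obtain ⟨-, -, -, hmono, hX0, -, -, -, hleft⟩ := h
  rw [mem_pwb, mem_wbr, mem_archs, mem_hpw, mem_saws_iff]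
  subst hm hw
  refine ⟨⟨⟨⟨⟨h0, hfr, hbw, hinj⟩, hH⟩, harch⟩, hwb⟩, fun i h1 h2 => ?_⟩
  have a := hleft i h2 h1
  have b := (hmono i h2).2
  rw [Tab.walk_apply_of_le h2, Tab.walk_apply_of_le (Nat.zero_le _), Tab.walk_apply_of_le le_rfl, Arm.pt_apply_zero,
    Arm.pt_apply_zero, Arm.pt_apply_zero, hX0]
  constructor <;> omega

/-- A table walk satisfying `Tab.Facts` is an IRREDUCIBLE positive wall bridge as soon as every interior even surface visit `k`
(`Y_k = 0`) carries a NON-RENEWAL WITNESS: either an earlier time `1 ≤ i ≤ k` with `X_i > X_k` (the first piece is not a bridge) or a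
later time `k < j ≤ L` with `X_j ≤ X_k` (the second piece is not a bridge).  The witness clause is decidable from the tables; the length
`m = L` and the walk are symbolic. [cite: MadrasSlade1993, Section 4.2, Definition 4.2.1] [cite: Kesten1963SAW, Section 4] -/
theorem mem_ipwb_of_facts_of_witness {L m : ℕ} {X Y : ℕ → ℤ} {w : ℕ → Site 2} (hw : w = Tab.walk L X Y) (h : Tab.Facts L X Y)
    (hm : m = L) (hL : 1 ≤ L)
    (hnr : ∀ k < L, 1 ≤ k → k % 2 = 0 → Y k = 0 → (∃ i ∈ Finset.Icc 1 k, X k < X i) ∨ (∃ j ∈ Finset.Ioc k L, X j ≤ X k)) :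
    w ∈ ipwb m := by
  rw [mem_ipwb]
  refine ⟨mem_pwb_of_facts_bl hw h hm, by omega, fun k hk1 hk2 hren => ?_⟩
  obtain ⟨⟨-, hb1, hb2⟩, hk, hY⟩ := hren
  subst hm hw
  rw [Tab.walk_apply_of_le hk2.le, Arm.pt_apply_one] at hY
  rcases hnr k hk2 hk1 hk hY with ⟨i, hi, hXi⟩ | ⟨j, hj, hXj⟩
  · rw [Finset.mem_Icc] at hi
    have b := (hb1 i hi.1 hi.2).2
    rw [Tab.walk_apply_of_le (hi.2.trans hk2.le), Tab.walk_apply_of_le hk2.le, Arm.pt_apply_zero, Arm.pt_apply_zero] at b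
    omega
  · rw [Finset.mem_Ioc] at hj
    have b := (hb2 (j - k) (by omega) (by omega)).1
    simp only at b
    rw [show k + (j - k) = j by omega, Tab.walk_apply_of_le hj.2, Nat.add_zero, Tab.walk_apply_of_le hk2.le,
      Arm.pt_apply_zero, Arm.pt_apply_zero] at b
    omega

/-- Weighted count of an exhibited family: `N` pairwise distinct irreducible positive wall bridges of length `m`, each with `v`
surface visits, give `N · y^v ≤ Λ_m(y)` (`y ≥ 0`). [cite: Kesten1963SAW, Section 4] [cite: MadrasSlade1993, Section 4.2] -/
theorem card_mul_pow_le_IPWB {N v m : ℕ} {W : Fin N → ℕ → Site 2} (hW : Function.Injective W) (hmem : ∀ i, W i ∈ ipwb m)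
    (hv : ∀ i, visits m (W i) = v) (hy : 0 ≤ y) : (N : ℝ) * y ^ v ≤ IPWB m y := by
  classical
  have hsub : Finset.univ.image W ⊆ ipwb m := by
    intro ω hω
    obtain ⟨i, -, rfl⟩ := Finset.mem_image.1 hω
    exact hmem i
  calc (N : ℝ) * y ^ v = ∑ i : Fin N, y ^ visits m (W i) := by simp [hv]
    _ = ∑ ω ∈ Finset.univ.image W, y ^ visits m ω := by rw [Finset.sum_image fun i _ j _ h => hW h]
    _ ≤ IPWB m y := Finset.sum_le_sum_of_subset_of_nonneg hsub fun _ _ _ => pow_nonneg hy _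

/-- Two exhibited families with DIFFERENT visit numbers are disjoint, so their weighted counts add:
`N₁ y^{v₁} + N₂ y^{v₂} ≤ Λ_m(y)` (`y ≥ 0`). [cite: Kesten1963SAW, Section 4] [cite: MadrasSlade1993, Section 4.2] -/
theorem card_mul_pow_add_le_IPWB {N₁ N₂ v₁ v₂ m : ℕ} {W₁ : Fin N₁ → ℕ → Site 2} {W₂ : Fin N₂ → ℕ → Site 2}
    (hW₁ : Function.Injective W₁) (hW₂ : Function.Injective W₂) (hmem₁ : ∀ i, W₁ i ∈ ipwb m) (hmem₂ : ∀ i, W₂ i ∈ ipwb m)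
    (hv₁ : ∀ i, visits m (W₁ i) = v₁) (hv₂ : ∀ i, visits m (W₂ i) = v₂) (hne : v₁ ≠ v₂) (hy : 0 ≤ y) :
    (N₁ : ℝ) * y ^ v₁ + N₂ * y ^ v₂ ≤ IPWB m y := by
  classical
  have hsub : Finset.univ.image W₁ ∪ Finset.univ.image W₂ ⊆ ipwb m := by
    intro ω hω
    rcases Finset.mem_union.1 hω with h | h
    · obtain ⟨i, -, rfl⟩ := Finset.mem_image.1 h; exact hmem₁ i
    · obtain ⟨i, -, rfl⟩ := Finset.mem_image.1 h; exact hmem₂ i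
  have hdisj : Disjoint (Finset.univ.image W₁) (Finset.univ.image W₂) := by
    rw [Finset.disjoint_left]
    intro ω h₁ h₂
    obtain ⟨i, -, rfl⟩ := Finset.mem_image.1 h₁
    obtain ⟨j, -, hj⟩ := Finset.mem_image.1 h₂
    have := hv₂ j
    rw [hj, hv₁ i] at this
    exact hne this
  calc (N₁ : ℝ) * y ^ v₁ + N₂ * y ^ v₂ = ∑ i : Fin N₁, y ^ visits m (W₁ i) + ∑ i : Fin N₂, y ^ visits m (W₂ i) := by simp [hv₁, hv₂]
    _ = ∑ ω ∈ Finset.univ.image W₁, y ^ visits m ω + ∑ ω ∈ Finset.univ.image W₂, y ^ visits m ω := by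
        rw [Finset.sum_image fun i _ j _ h => hW₁ h, Finset.sum_image fun i _ j _ h => hW₂ h]
    _ = ∑ ω ∈ Finset.univ.image W₁ ∪ Finset.univ.image W₂, y ^ visits m ω := (Finset.sum_union hdisj).symm
    _ ≤ IPWB m y := Finset.sum_le_sum_of_subset_of_nonneg hsub fun _ _ _ => pow_nonneg hy _

/-! ### §2  The tables -/

namespace FourteenTwo

/-- `X`-table of the two-visit irreducible block of length fourteen no. 0, `(0,0)(1,0)(2,0)(3,0)(3,-1)(2,-1)(2,-2)(3,-2)(4,-2)(5,-2)(6,-2)(6,-1)(7,-1)(7,0)(8,0)`. [cite: EntingJensen2009, Section 7.4.2, Fig. 7.10] -/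
def x0 : ℕ → ℤ
  | 0 => 0 | 1 => 1 | 2 => 2 | 3 => 3 | 4 => 3 | 5 => 2 | 6 => 2 | 7 => 3 | 8 => 4 | 9 => 5 | 10 => 6 | 11 => 6 | 12 => 7 | 13 => 7 | _ => 8

/-- `Y`-table of the two-visit irreducible block of length fourteen no. 0. [cite: EntingJensen2009, Section 7.4.2, Fig. 7.10] -/
def y0 : ℕ → ℤ
  | 0 => 0 | 1 => 0 | 2 => 0 | 3 => 0 | 4 => -1 | 5 => -1 | 6 => -2 | 7 => -2 | 8 => -2 | 9 => -2 | 10 => -2 | 11 => -1 | 12 => -1 | 13 => 0 | _ => 0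

/-- `X`-table of the two-visit irreducible block of length fourteen no. 1, `(0,0)(1,0)(2,0)(3,0)(3,-1)(2,-1)(2,-2)(3,-2)(4,-2)(5,-2)(6,-2)(6,-1)(5,-1)(5,0)(6,0)`. [cite: EntingJensen2009, Section 7.4.2, Fig. 7.10] -/
def x1 : ℕ → ℤ
  | 0 => 0 | 1 => 1 | 2 => 2 | 3 => 3 | 4 => 3 | 5 => 2 | 6 => 2 | 7 => 3 | 8 => 4 | 9 => 5 | 10 => 6 | 11 => 6 | 12 => 5 | 13 => 5 | _ => 6

/-- `Y`-table of the two-visit irreducible block of length fourteen no. 1. [cite: EntingJensen2009, Section 7.4.2, Fig. 7.10] -/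
def y1 : ℕ → ℤ
  | 0 => 0 | 1 => 0 | 2 => 0 | 3 => 0 | 4 => -1 | 5 => -1 | 6 => -2 | 7 => -2 | 8 => -2 | 9 => -2 | 10 => -2 | 11 => -1 | 12 => -1 | 13 => 0 | _ => 0

/-- `X`-table of the two-visit irreducible block of length fourteen no. 2, `(0,0)(1,0)(2,0)(3,0)(3,-1)(2,-1)(2,-2)(3,-2)(4,-2)(4,-1)(5,-1)(6,-1)(7,-1)(7,0)(8,0)`. [cite: EntingJensen2009, Section 7.4.2, Fig. 7.10] -/
def x2 : ℕ → ℤ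
  | 0 => 0 | 1 => 1 | 2 => 2 | 3 => 3 | 4 => 3 | 5 => 2 | 6 => 2 | 7 => 3 | 8 => 4 | 9 => 4 | 10 => 5 | 11 => 6 | 12 => 7 | 13 => 7 | _ => 8

/-- `Y`-table of the two-visit irreducible block of length fourteen no. 2. [cite: EntingJensen2009, Section 7.4.2, Fig. 7.10] -/
def y2 : ℕ → ℤ
  | 0 => 0 | 1 => 0 | 2 => 0 | 3 => 0 | 4 => -1 | 5 => -1 | 6 => -2 | 7 => -2 | 8 => -2 | 9 => -1 | 10 => -1 | 11 => -1 | 12 => -1 | 13 => 0 | _ => 0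

/-- The 3 `X`-tables as one family. [cite: EntingJensen2009, Section 7.4.2, Fig. 7.10] -/
def TX : Fin 3 → ℕ → ℤ
  | ⟨0, _⟩ => x0 | ⟨1, _⟩ => x1 | _ => x2

/-- The 3 `Y`-tables as one family. [cite: EntingJensen2009, Section 7.4.2, Fig. 7.10] -/
def TY : Fin 3 → ℕ → ℤ
  | ⟨0, _⟩ => y0 | ⟨1, _⟩ => y1 | _ => y2

/-- **The 3 two-visit irreducible block of length fourteens** as explicit walks (`Tab.walk`). [cite: EntingJensen2009, Section 7.4.2, Fig. 7.10] -/
def W (i : Fin 3) : ℕ → Site 2 := Tab.walk 14 (TX i) (TY i)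

end FourteenTwo

namespace SixteenTwo

/-- `X`-table of the two-visit irreducible block of length sixteen no. 0, `(0,0)(1,0)(2,0)(3,0)(3,-1)(2,-1)(2,-2)(3,-2)(4,-2)(5,-2)(6,-2)(7,-2)(8,-2)(8,-1)(9,-1)(9,0)(10,0)`. [cite: EntingJensen2009, Section 7.4.2, Fig. 7.10] -/
def x0 : ℕ → ℤ
  | 0 => 0 | 1 => 1 | 2 => 2 | 3 => 3 | 4 => 3 | 5 => 2 | 6 => 2 | 7 => 3 | 8 => 4 | 9 => 5 | 10 => 6 | 11 => 7 | 12 => 8 | 13 => 8 | 14 => 9 | 15 => 9 | _ => 10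

/-- `Y`-table of the two-visit irreducible block of length sixteen no. 0. [cite: EntingJensen2009, Section 7.4.2, Fig. 7.10] -/
def y0 : ℕ → ℤ
  | 0 => 0 | 1 => 0 | 2 => 0 | 3 => 0 | 4 => -1 | 5 => -1 | 6 => -2 | 7 => -2 | 8 => -2 | 9 => -2 | 10 => -2 | 11 => -2 | 12 => -2 | 13 => -1 | 14 => -1 | 15 => 0 | _ => 0

/-- `X`-table of the two-visit irreducible block of length sixteen no. 1, `(0,0)(1,0)(2,0)(3,0)(3,-1)(2,-1)(2,-2)(3,-2)(4,-2)(5,-2)(6,-2)(7,-2)(8,-2)(8,-1)(7,-1)(7,0)(8,0)`. [cite: EntingJensen2009, Section 7.4.2, Fig. 7.10] -/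
def x1 : ℕ → ℤ
  | 0 => 0 | 1 => 1 | 2 => 2 | 3 => 3 | 4 => 3 | 5 => 2 | 6 => 2 | 7 => 3 | 8 => 4 | 9 => 5 | 10 => 6 | 11 => 7 | 12 => 8 | 13 => 8 | 14 => 7 | 15 => 7 | _ => 8

/-- `Y`-table of the two-visit irreducible block of length sixteen no. 1. [cite: EntingJensen2009, Section 7.4.2, Fig. 7.10] -/
def y1 : ℕ → ℤ
  | 0 => 0 | 1 => 0 | 2 => 0 | 3 => 0 | 4 => -1 | 5 => -1 | 6 => -2 | 7 => -2 | 8 => -2 | 9 => -2 | 10 => -2 | 11 => -2 | 12 => -2 | 13 => -1 | 14 => -1 | 15 => 0 | _ => 0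

/-- `X`-table of the two-visit irreducible block of length sixteen no. 2, `(0,0)(1,0)(2,0)(3,0)(3,-1)(2,-1)(2,-2)(3,-2)(4,-2)(5,-2)(6,-2)(6,-1)(7,-1)(8,-1)(9,-1)(9,0)(10,0)`. [cite: EntingJensen2009, Section 7.4.2, Fig. 7.10] -/
def x2 : ℕ → ℤ
  | 0 => 0 | 1 => 1 | 2 => 2 | 3 => 3 | 4 => 3 | 5 => 2 | 6 => 2 | 7 => 3 | 8 => 4 | 9 => 5 | 10 => 6 | 11 => 6 | 12 => 7 | 13 => 8 | 14 => 9 | 15 => 9 | _ => 10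

/-- `Y`-table of the two-visit irreducible block of length sixteen no. 2. [cite: EntingJensen2009, Section 7.4.2, Fig. 7.10] -/
def y2 : ℕ → ℤ
  | 0 => 0 | 1 => 0 | 2 => 0 | 3 => 0 | 4 => -1 | 5 => -1 | 6 => -2 | 7 => -2 | 8 => -2 | 9 => -2 | 10 => -2 | 11 => -1 | 12 => -1 | 13 => -1 | 14 => -1 | 15 => 0 | _ => 0

/-- `X`-table of the two-visit irreducible block of length sixteen no. 3, `(0,0)(1,0)(2,0)(3,0)(3,-1)(2,-1)(2,-2)(3,-2)(4,-2)(4,-1)(5,-1)(6,-1)(7,-1)(8,-1)(9,-1)(9,0)(10,0)`. [cite: EntingJensen2009, Section 7.4.2, Fig. 7.10] -/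
def x3 : ℕ → ℤ
  | 0 => 0 | 1 => 1 | 2 => 2 | 3 => 3 | 4 => 3 | 5 => 2 | 6 => 2 | 7 => 3 | 8 => 4 | 9 => 4 | 10 => 5 | 11 => 6 | 12 => 7 | 13 => 8 | 14 => 9 | 15 => 9 | _ => 10

/-- `Y`-table of the two-visit irreducible block of length sixteen no. 3. [cite: EntingJensen2009, Section 7.4.2, Fig. 7.10] -/
def y3 : ℕ → ℤ
  | 0 => 0 | 1 => 0 | 2 => 0 | 3 => 0 | 4 => -1 | 5 => -1 | 6 => -2 | 7 => -2 | 8 => -2 | 9 => -1 | 10 => -1 | 11 => -1 | 12 => -1 | 13 => -1 | 14 => -1 | 15 => 0 | _ => 0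

/-- `X`-table of the two-visit irreducible block of length sixteen no. 4, `(0,0)(1,0)(2,0)(3,0)(3,-1)(2,-1)(2,-2)(3,-2)(3,-3)(4,-3)(5,-3)(5,-2)(6,-2)(6,-1)(7,-1)(7,0)(8,0)`. [cite: EntingJensen2009, Section 7.4.2, Fig. 7.10] -/
def x4 : ℕ → ℤ
  | 0 => 0 | 1 => 1 | 2 => 2 | 3 => 3 | 4 => 3 | 5 => 2 | 6 => 2 | 7 => 3 | 8 => 3 | 9 => 4 | 10 => 5 | 11 => 5 | 12 => 6 | 13 => 6 | 14 => 7 | 15 => 7 | _ => 8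

/-- `Y`-table of the two-visit irreducible block of length sixteen no. 4. [cite: EntingJensen2009, Section 7.4.2, Fig. 7.10] -/
def y4 : ℕ → ℤ
  | 0 => 0 | 1 => 0 | 2 => 0 | 3 => 0 | 4 => -1 | 5 => -1 | 6 => -2 | 7 => -2 | 8 => -3 | 9 => -3 | 10 => -3 | 11 => -2 | 12 => -2 | 13 => -1 | 14 => -1 | 15 => 0 | _ => 0

/-- `X`-table of the two-visit irreducible block of length sixteen no. 5, `(0,0)(1,0)(2,0)(3,0)(3,-1)(2,-1)(2,-2)(3,-2)(3,-3)(4,-3)(5,-3)(5,-2)(6,-2)(6,-1)(5,-1)(5,0)(6,0)`. [cite: EntingJensen2009, Section 7.4.2, Fig. 7.10] -/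
def x5 : ℕ → ℤ
  | 0 => 0 | 1 => 1 | 2 => 2 | 3 => 3 | 4 => 3 | 5 => 2 | 6 => 2 | 7 => 3 | 8 => 3 | 9 => 4 | 10 => 5 | 11 => 5 | 12 => 6 | 13 => 6 | 14 => 5 | 15 => 5 | _ => 6

/-- `Y`-table of the two-visit irreducible block of length sixteen no. 5. [cite: EntingJensen2009, Section 7.4.2, Fig. 7.10] -/
def y5 : ℕ → ℤ
  | 0 => 0 | 1 => 0 | 2 => 0 | 3 => 0 | 4 => -1 | 5 => -1 | 6 => -2 | 7 => -2 | 8 => -3 | 9 => -3 | 10 => -3 | 11 => -2 | 12 => -2 | 13 => -1 | 14 => -1 | 15 => 0 | _ => 0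

/-- `X`-table of the two-visit irreducible block of length sixteen no. 6, `(0,0)(1,0)(2,0)(3,0)(3,-1)(2,-1)(2,-2)(3,-2)(3,-3)(4,-3)(5,-3)(5,-2)(4,-2)(4,-1)(5,-1)(5,0)(6,0)`. [cite: EntingJensen2009, Section 7.4.2, Fig. 7.10] -/
def x6 : ℕ → ℤ
  | 0 => 0 | 1 => 1 | 2 => 2 | 3 => 3 | 4 => 3 | 5 => 2 | 6 => 2 | 7 => 3 | 8 => 3 | 9 => 4 | 10 => 5 | 11 => 5 | 12 => 4 | 13 => 4 | 14 => 5 | 15 => 5 | _ => 6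

/-- `Y`-table of the two-visit irreducible block of length sixteen no. 6. [cite: EntingJensen2009, Section 7.4.2, Fig. 7.10] -/
def y6 : ℕ → ℤ
  | 0 => 0 | 1 => 0 | 2 => 0 | 3 => 0 | 4 => -1 | 5 => -1 | 6 => -2 | 7 => -2 | 8 => -3 | 9 => -3 | 10 => -3 | 11 => -2 | 12 => -2 | 13 => -1 | 14 => -1 | 15 => 0 | _ => 0

/-- `X`-table of the two-visit irreducible block of length sixteen no. 7, `(0,0)(1,0)(2,0)(3,0)(3,-1)(2,-1)(2,-2)(1,-2)(1,-3)(2,-3)(3,-3)(3,-2)(4,-2)(4,-1)(5,-1)(5,0)(6,0)`. [cite: EntingJensen2009, Section 7.4.2, Fig. 7.10] -/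
def x7 : ℕ → ℤ
  | 0 => 0 | 1 => 1 | 2 => 2 | 3 => 3 | 4 => 3 | 5 => 2 | 6 => 2 | 7 => 1 | 8 => 1 | 9 => 2 | 10 => 3 | 11 => 3 | 12 => 4 | 13 => 4 | 14 => 5 | 15 => 5 | _ => 6

/-- `Y`-table of the two-visit irreducible block of length sixteen no. 7. [cite: EntingJensen2009, Section 7.4.2, Fig. 7.10] -/
def y7 : ℕ → ℤ
  | 0 => 0 | 1 => 0 | 2 => 0 | 3 => 0 | 4 => -1 | 5 => -1 | 6 => -2 | 7 => -2 | 8 => -3 | 9 => -3 | 10 => -3 | 11 => -2 | 12 => -2 | 13 => -1 | 14 => -1 | 15 => 0 | _ => 0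

/-- `X`-table of the two-visit irreducible block of length sixteen no. 8, `(0,0)(1,0)(1,-1)(2,-1)(3,-1)(3,0)(4,0)(5,0)(5,-1)(4,-1)(4,-2)(5,-2)(6,-2)(6,-1)(7,-1)(7,0)(8,0)`. [cite: EntingJensen2009, Section 7.4.2, Fig. 7.10] -/
def x8 : ℕ → ℤ
  | 0 => 0 | 1 => 1 | 2 => 1 | 3 => 2 | 4 => 3 | 5 => 3 | 6 => 4 | 7 => 5 | 8 => 5 | 9 => 4 | 10 => 4 | 11 => 5 | 12 => 6 | 13 => 6 | 14 => 7 | 15 => 7 | _ => 8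

/-- `Y`-table of the two-visit irreducible block of length sixteen no. 8. [cite: EntingJensen2009, Section 7.4.2, Fig. 7.10] -/
def y8 : ℕ → ℤ
  | 0 => 0 | 1 => 0 | 2 => -1 | 3 => -1 | 4 => -1 | 5 => 0 | 6 => 0 | 7 => 0 | 8 => -1 | 9 => -1 | 10 => -2 | 11 => -2 | 12 => -2 | 13 => -1 | 14 => -1 | 15 => 0 | _ => 0

/-- `X`-table of the two-visit irreducible block of length sixteen no. 9, `(0,0)(1,0)(1,-1)(2,-1)(2,-2)(3,-2)(4,-2)(5,-2)(6,-2)(6,-1)(5,-1)(4,-1)(3,-1)(3,0)(4,0)(5,0)(6,0)`. [cite: EntingJensen2009, Section 7.4.2, Fig. 7.10] -/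
def x9 : ℕ → ℤ
  | 0 => 0 | 1 => 1 | 2 => 1 | 3 => 2 | 4 => 2 | 5 => 3 | 6 => 4 | 7 => 5 | 8 => 6 | 9 => 6 | 10 => 5 | 11 => 4 | 12 => 3 | 13 => 3 | 14 => 4 | 15 => 5 | _ => 6

/-- `Y`-table of the two-visit irreducible block of length sixteen no. 9. [cite: EntingJensen2009, Section 7.4.2, Fig. 7.10] -/
def y9 : ℕ → ℤ
  | 0 => 0 | 1 => 0 | 2 => -1 | 3 => -1 | 4 => -2 | 5 => -2 | 6 => -2 | 7 => -2 | 8 => -2 | 9 => -1 | 10 => -1 | 11 => -1 | 12 => -1 | 13 => 0 | 14 => 0 | 15 => 0 | _ => 0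

/-- `X`-table of the two-visit irreducible block of length sixteen no. 10, `(0,0)(1,0)(1,-1)(2,-1)(2,-2)(3,-2)(3,-3)(4,-3)(5,-3)(5,-2)(4,-2)(4,-1)(3,-1)(3,0)(4,0)(5,0)(6,0)`. [cite: EntingJensen2009, Section 7.4.2, Fig. 7.10] -/
def x10 : ℕ → ℤ
  | 0 => 0 | 1 => 1 | 2 => 1 | 3 => 2 | 4 => 2 | 5 => 3 | 6 => 3 | 7 => 4 | 8 => 5 | 9 => 5 | 10 => 4 | 11 => 4 | 12 => 3 | 13 => 3 | 14 => 4 | 15 => 5 | _ => 6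

/-- `Y`-table of the two-visit irreducible block of length sixteen no. 10. [cite: EntingJensen2009, Section 7.4.2, Fig. 7.10] -/
def y10 : ℕ → ℤ
  | 0 => 0 | 1 => 0 | 2 => -1 | 3 => -1 | 4 => -2 | 5 => -2 | 6 => -3 | 7 => -3 | 8 => -3 | 9 => -2 | 10 => -2 | 11 => -1 | 12 => -1 | 13 => 0 | 14 => 0 | 15 => 0 | _ => 0

/-- The 11 `X`-tables as one family. [cite: EntingJensen2009, Section 7.4.2, Fig. 7.10] -/
def TX : Fin 11 → ℕ → ℤ
  | ⟨0, _⟩ => x0 | ⟨1, _⟩ => x1 | ⟨2, _⟩ => x2 | ⟨3, _⟩ => x3 | ⟨4, _⟩ => x4 | ⟨5, _⟩ => x5 | ⟨6, _⟩ => x6 | ⟨7, _⟩ => x7 | ⟨8, _⟩ => x8 | ⟨9, _⟩ => x9 | _ => x10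

/-- The 11 `Y`-tables as one family. [cite: EntingJensen2009, Section 7.4.2, Fig. 7.10] -/
def TY : Fin 11 → ℕ → ℤ
  | ⟨0, _⟩ => y0 | ⟨1, _⟩ => y1 | ⟨2, _⟩ => y2 | ⟨3, _⟩ => y3 | ⟨4, _⟩ => y4 | ⟨5, _⟩ => y5 | ⟨6, _⟩ => y6 | ⟨7, _⟩ => y7 | ⟨8, _⟩ => y8 | ⟨9, _⟩ => y9 | _ => y10

/-- **The 11 two-visit irreducible block of length sixteens** as explicit walks (`Tab.walk`). [cite: EntingJensen2009, Section 7.4.2, Fig. 7.10] -/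
def W (i : Fin 11) : ℕ → Site 2 := Tab.walk 16 (TX i) (TY i)

end SixteenTwo

namespace EighteenThree

/-- `X`-table of the three-visit irreducible block of length eighteen no. 0, `(0,0)(1,0)(2,0)(3,0)(4,0)(5,0)(5,-1)(4,-1)(3,-1)(2,-1)(2,-2)(3,-2)(4,-2)(5,-2)(6,-2)(6,-1)(7,-1)(7,0)(8,0)`. [cite: EntingJensen2009, Section 7.4.2, Fig. 7.10] -/
def x0 : ℕ → ℤ
  | 0 => 0 | 1 => 1 | 2 => 2 | 3 => 3 | 4 => 4 | 5 => 5 | 6 => 5 | 7 => 4 | 8 => 3 | 9 => 2 | 10 => 2 | 11 => 3 | 12 => 4 | 13 => 5 | 14 => 6 | 15 => 6 | 16 => 7 | 17 => 7 | _ => 8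

/-- `Y`-table of the three-visit irreducible block of length eighteen no. 0. [cite: EntingJensen2009, Section 7.4.2, Fig. 7.10] -/
def y0 : ℕ → ℤ
  | 0 => 0 | 1 => 0 | 2 => 0 | 3 => 0 | 4 => 0 | 5 => 0 | 6 => -1 | 7 => -1 | 8 => -1 | 9 => -1 | 10 => -2 | 11 => -2 | 12 => -2 | 13 => -2 | 14 => -2 | 15 => -1 | 16 => -1 | 17 => 0 | _ => 0

/-- **The three-visit irreducible block of length eighteen** as an explicit walk (`Tab.walk`). [cite: EntingJensen2009, Section 7.4.2, Fig. 7.10] -/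
def W (_ : Fin 1) : ℕ → Site 2 := Tab.walk 18 x0 y0

end EighteenThree

/-! ### §3  Facts, visits, codes, memberships -/

namespace FourteenTwo

/-- Coordinate facts (left-proper wall bridges of length fourteen), by `decide`. [cite: EntingJensen2009, Section 7.4.2, Fig. 7.10] -/
theorem facts : ∀ i : Fin 3, Tab.Facts 14 (TX i) (TY i) := by unfold Tab.Facts; decide

/-- Non-renewal witnesses at the interior surface visit (time `2`: the walk returns to the abscissa `2` at time `5`), by `decide`.
[cite: MadrasSlade1993, Section 4.2, Definition 4.2.1] -/
theorem witness : ∀ i : Fin 3, ∀ k < 14, 1 ≤ k → k % 2 = 0 → TY i k = 0 →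
    (∃ i' ∈ Finset.Icc 1 k, TX i k < TX i i') ∨ (∃ j ∈ Finset.Ioc k 14, TX i j ≤ TX i k) := by decide

/-- Two surface visits each (kernel evaluation). [cite: BeatonBousquetMelouDeGierDuminilCopinGuttmann2014, Section 3.1] -/
theorem visits_W : ∀ i : Fin 3, visits 14 (W i) = 2 := by decide

/-- An injective code: the abscissae at times `9`, `12`. [cite: EntingJensen2009, Section 7.4.2, Fig. 7.10] -/
theorem code_injective : ∀ i j : Fin 3, TX i 9 = TX j 9 → TX i 12 = TX j 12 → i = j := by decide

/-- The three blocks are pairwise distinct. [cite: EntingJensen2009, Section 7.4.2, Fig. 7.10] -/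
theorem W_injective : Function.Injective (W : Fin 3 → ℕ → Site 2) := by
  intro i j h
  have h9 := congrFun (congrFun h 9) 0
  have h12 := congrFun (congrFun h 12) 0
  simp only [W, Tab.walk, Arm.pt_apply_zero, show min 9 14 = 9 from rfl, show min 12 14 = 12 from rfl] at h9 h12
  exact code_injective i j h9 h12

/-- ★ The three two-visit blocks are irreducible positive wall bridges of length fourteen (length symbolic).
[cite: MadrasSlade1993, Section 4.2, Definition 4.2.1] [cite: Kesten1963SAW, Section 4] -/
theorem W_mem_ipwb {m : ℕ} (hm : m = 14) (i : Fin 3) : W i ∈ ipwb m :=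
  mem_ipwb_of_facts_of_witness (w := W i) rfl (facts i) hm (by norm_num) (witness i)

end FourteenTwo

namespace SixteenTwo

/-- Coordinate facts (left-proper wall bridges of length sixteen), by `decide`. [cite: EntingJensen2009, Section 7.4.2, Fig. 7.10] -/
theorem facts : ∀ i : Fin 11, Tab.Facts 16 (TX i) (TY i) := by unfold Tab.Facts; decide

/-- Non-renewal witnesses at the interior surface visit of each block, by `decide`. [cite: MadrasSlade1993, Section 4.2, Definition 4.2.1] -/
theorem witness : ∀ i : Fin 11, ∀ k < 16, 1 ≤ k → k % 2 = 0 → TY i k = 0 →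
    (∃ i' ∈ Finset.Icc 1 k, TX i k < TX i i') ∨ (∃ j ∈ Finset.Ioc k 16, TX i j ≤ TX i k) := by decide

/-- Two surface visits each (kernel evaluation). [cite: BeatonBousquetMelouDeGierDuminilCopinGuttmann2014, Section 3.1] -/
theorem visits_W : ∀ i : Fin 11, visits 16 (W i) = 2 := by decide

/-- An injective code: the abscissae at times `10`, `12`, `14`. [cite: EntingJensen2009, Section 7.4.2, Fig. 7.10] -/
theorem code_injective : ∀ i j : Fin 11, TX i 10 = TX j 10 → TX i 12 = TX j 12 → TX i 14 = TX j 14 → i = j := by decide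

/-- The eleven blocks are pairwise distinct. [cite: EntingJensen2009, Section 7.4.2, Fig. 7.10] -/
theorem W_injective : Function.Injective (W : Fin 11 → ℕ → Site 2) := by
  intro i j h
  have h10 := congrFun (congrFun h 10) 0
  have h12 := congrFun (congrFun h 12) 0
  have h14 := congrFun (congrFun h 14) 0
  simp only [W, Tab.walk, Arm.pt_apply_zero, show min 10 16 = 10 from rfl, show min 12 16 = 12 from rfl,
    show min 14 16 = 14 from rfl] at h10 h12 h14
  exact code_injective i j h10 h12 h14

/-- ★ The eleven two-visit blocks are irreducible positive wall bridges of length sixteen (length symbolic).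
[cite: MadrasSlade1993, Section 4.2, Definition 4.2.1] [cite: Kesten1963SAW, Section 4] -/
theorem W_mem_ipwb {m : ℕ} (hm : m = 16) (i : Fin 11) : W i ∈ ipwb m :=
  mem_ipwb_of_facts_of_witness (w := W i) rfl (facts i) hm (by norm_num) (witness i)

end SixteenTwo

namespace EighteenThree

/-- Coordinate facts (a left-proper wall bridge of length eighteen), by `decide`. [cite: EntingJensen2009, Section 7.4.2, Fig. 7.10] -/
theorem facts : Tab.Facts 18 x0 y0 := by unfold Tab.Facts; decide

/-- Non-renewal witnesses at the two interior surface visits (times `2` and `4`), by `decide`. [cite: MadrasSlade1993, Section 4.2, Definition 4.2.1] -/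
theorem witness : ∀ k < 18, 1 ≤ k → k % 2 = 0 → y0 k = 0 →
    (∃ i' ∈ Finset.Icc 1 k, x0 k < x0 i') ∨ (∃ j ∈ Finset.Ioc k 18, x0 j ≤ x0 k) := by decide

/-- Three surface visits (kernel evaluation). [cite: BeatonBousquetMelouDeGierDuminilCopinGuttmann2014, Section 3.1] -/
theorem visits_W : ∀ i : Fin 1, visits 18 (W i) = 3 := by decide

/-- A one-element family is injective. [cite: EntingJensen2009, Section 7.4.2, Fig. 7.10] -/
theorem W_injective : Function.Injective (W : Fin 1 → ℕ → Site 2) := fun i j _ => Subsingleton.elim i j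

/-- ★ The three-visit block is an irreducible positive wall bridge of length eighteen (length symbolic).
[cite: MadrasSlade1993, Section 4.2, Definition 4.2.1] [cite: Kesten1963SAW, Section 4] -/
theorem W_mem_ipwb {m : ℕ} (hm : m = 18) (i : Fin 1) : W i ∈ ipwb m :=
  mem_ipwb_of_facts_of_witness (w := W i) rfl facts hm (by norm_num) witness

end EighteenThree

namespace TwelveOne

/-- The first six of the nine one-visit seeds of length twelve of «FIFTH-ORDER-LOWER» (`Twelve.W 0, …, Twelve.W 5`) — the
LEFT-PROPER ones (`X_i ≥ 1` for `1 ≤ i ≤ 12`; the seeds `6, 7, 8` step left of the start column), as a family indexed by `Fin 6`.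
[cite: EntingJensen2009, Section 7.4.2, Fig. 7.10] -/
def ι (i : Fin 6) : Fin 9 := Fin.castLE (by norm_num) i

/-- The six positive one-visit blocks of length twelve. [cite: EntingJensen2009, Section 7.4.2, Fig. 7.10] -/
def W (i : Fin 6) : ℕ → Site 2 := Twelve.W (ι i)

/-- Coordinate facts INCLUDING left-properness (`Tab.Facts`, not only `Tab.Facts₀`), by `decide`. [cite: EntingJensen2009, Section 7.4.2, Fig. 7.10] -/
theorem facts : ∀ i : Fin 6, Tab.Facts 12 (Twelve.TX (ι i)) (Twelve.TY (ι i)) := by unfold Tab.Facts ι; decide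

/-- No interior surface visit (the witness clause holds vacuously), by `decide`. [cite: MadrasSlade1993, Section 4.2, Definition 4.2.1] -/
theorem witness : ∀ i : Fin 6, ∀ k < 12, 1 ≤ k → k % 2 = 0 → Twelve.TY (ι i) k = 0 →
    (∃ i' ∈ Finset.Icc 1 k, Twelve.TX (ι i) k < Twelve.TX (ι i) i') ∨ (∃ j ∈ Finset.Ioc k 12, Twelve.TX (ι i) j ≤ Twelve.TX (ι i) k) := by
  unfold ι; decide

/-- One surface visit each. [cite: BeatonBousquetMelouDeGierDuminilCopinGuttmann2014, Section 3.1] -/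
theorem visits_W (i : Fin 6) : visits 12 (W i) = 1 := Twelve.visits_W (ι i)

/-- The six blocks are pairwise distinct. [cite: EntingJensen2009, Section 7.4.2, Fig. 7.10] -/
theorem W_injective : Function.Injective (W : Fin 6 → ℕ → Site 2) := fun _ _ h => Fin.castLE_injective _ (Twelve.W_injective h)

/-- ★ The six one-visit seeds `Twelve.W 0, …, Twelve.W 5` are irreducible POSITIVE wall bridges of length twelve (length symbolic).
[cite: MadrasSlade1993, Section 4.2, Definition 4.2.1] [cite: Kesten1963SAW, Section 4] -/
theorem W_mem_ipwb {m : ℕ} (hm : m = 12) (i : Fin 6) : W i ∈ ipwb m :=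
  mem_ipwb_of_facts_of_witness (w := W i) rfl (facts i) hm (by norm_num) (witness i)

end TwelveOne

namespace FourteenOne

/-- Fifteen of the twenty-six one-visit walks of length fourteen of «FOURTEEN-SEEDS» (`Fourteen.W 7, …, Fourteen.W 21`) — the
LEFT-PROPER wall bridges among them (`0–6` return to the start column, `22–25` overshoot the final column), as a family indexed by `Fin 15`.
[cite: EntingJensen2009, Section 7.4.2, Fig. 7.10] -/
def ι (i : Fin 15) : Fin 26 := ⟨i.1 + 7, by omega⟩

/-- The fifteen positive one-visit blocks of length fourteen. [cite: EntingJensen2009, Section 7.4.2, Fig. 7.10] -/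
def W (i : Fin 15) : ℕ → Site 2 := Fourteen.W (ι i)

/-- Coordinate facts INCLUDING left-properness, by `decide`. [cite: EntingJensen2009, Section 7.4.2, Fig. 7.10] -/
theorem facts : ∀ i : Fin 15, Tab.Facts 14 (Fourteen.TX (ι i)) (Fourteen.TY (ι i)) := by unfold Tab.Facts ι; decide

/-- No interior surface visit (the witness clause holds vacuously), by `decide`. [cite: MadrasSlade1993, Section 4.2, Definition 4.2.1] -/
theorem witness : ∀ i : Fin 15, ∀ k < 14, 1 ≤ k → k % 2 = 0 → Fourteen.TY (ι i) k = 0 →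
    (∃ i' ∈ Finset.Icc 1 k, Fourteen.TX (ι i) k < Fourteen.TX (ι i) i') ∨
      (∃ j ∈ Finset.Ioc k 14, Fourteen.TX (ι i) j ≤ Fourteen.TX (ι i) k) := by
  unfold ι; decide

/-- One surface visit each. [cite: BeatonBousquetMelouDeGierDuminilCopinGuttmann2014, Section 3.1] -/
theorem visits_W (i : Fin 15) : visits 14 (W i) = 1 := Fourteen.visits_W (ι i)

/-- The index shift is injective. [cite: EntingJensen2009, Section 7.4.2, Fig. 7.10] -/
theorem ι_injective : Function.Injective (ι : Fin 15 → Fin 26) := by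
  intro i j h
  have := congrArg Fin.val h
  simp only [ι] at this
  exact Fin.ext (by omega)

/-- The fifteen blocks are pairwise distinct. [cite: EntingJensen2009, Section 7.4.2, Fig. 7.10] -/
theorem W_injective : Function.Injective (W : Fin 15 → ℕ → Site 2) := fun _ _ h => ι_injective (Fourteen.W_injective h)

/-- ★ The fifteen one-visit wall bridges `Fourteen.W 7, …, Fourteen.W 21` are irreducible POSITIVE wall bridges of length fourteen
(length symbolic). [cite: MadrasSlade1993, Section 4.2, Definition 4.2.1] [cite: Kesten1963SAW, Section 4] -/
theorem W_mem_ipwb {m : ℕ} (hm : m = 14) (i : Fin 15) : W i ∈ ipwb m :=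
  mem_ipwb_of_facts_of_witness (w := W i) rfl (facts i) hm (by norm_num) (witness i)

end FourteenOne

/-! ### §4  The sum bounds -/

/-- ★★ Length twelve, one-visit part: `6·y ≤ Λ₁₂(y)` (`y ≥ 0`, length symbolic). [cite: Kesten1963SAW, Section 4] [cite: MadrasSlade1993, Section 4.2] -/
theorem six_mul_le_IPWB_twelve {m : ℕ} (hm : m = 12) (hy : 0 ≤ y) : 6 * y ≤ IPWB m y := by
  have h := card_mul_pow_le_IPWB TwelveOne.W_injective (TwelveOne.W_mem_ipwb hm) (v := 1)
    (fun i => by rw [hm]; exact TwelveOne.visits_W i) hy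
  simpa using h

/-- ★★ Length fourteen: `15·y + 3·y² ≤ Λ₁₄(y)` (`y ≥ 0`, length symbolic) — fifteen one-visit and three two-visit irreducible positive
wall bridges. [cite: Kesten1963SAW, Section 4] [cite: MadrasSlade1993, Section 4.2] -/
theorem fifteen_mul_add_three_sq_le_IPWB_fourteen {m : ℕ} (hm : m = 14) (hy : 0 ≤ y) : 15 * y + 3 * y ^ 2 ≤ IPWB m y := by
  have h := card_mul_pow_add_le_IPWB FourteenOne.W_injective FourteenTwo.W_injective (FourteenOne.W_mem_ipwb hm)
    (FourteenTwo.W_mem_ipwb hm) (v₁ := 1) (v₂ := 2) (fun i => by rw [hm]; exact FourteenOne.visits_W i)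
    (fun i => by rw [hm]; exact FourteenTwo.visits_W i) (by norm_num) hy
  simpa using h



/-- ★★ Length sixteen, two-visit part: `11·y² ≤ Λ₁₆(y)` (`y ≥ 0`, length symbolic). [cite: Kesten1963SAW, Section 4] [cite: MadrasSlade1993, Section 4.2] -/
theorem eleven_sq_le_IPWB_sixteen {m : ℕ} (hm : m = 16) (hy : 0 ≤ y) : (11 : ℝ) * y ^ 2 ≤ IPWB m y := by
  have h := card_mul_pow_le_IPWB SixteenTwo.W_injective (SixteenTwo.W_mem_ipwb hm) (v := 2)
    (fun i => by rw [hm]; exact SixteenTwo.visits_W i) hy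
  exact_mod_cast h

/-- ★★ Length eighteen, three-visit part: `y³ ≤ Λ₁₈(y)` (`y ≥ 0`, length symbolic). [cite: Kesten1963SAW, Section 4] [cite: MadrasSlade1993, Section 4.2] -/
theorem cube_le_IPWB_eighteen {m : ℕ} (hm : m = 18) (hy : 0 ≤ y) : y ^ 3 ≤ IPWB m y := by
  have h := card_mul_pow_le_IPWB EighteenThree.W_injective (EighteenThree.W_mem_ipwb hm) (v := 3)
    (fun i => by rw [hm]; exact EighteenThree.visits_W i) hy
  simpa using h

end Literature.Probability.RandomPlanarGeometry.SAW.HexBW.Wall
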